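import Summits.QuantumFields.YangMills.Theorems.UnitScaleTiltProp7SymFrameGaugeResponseAt
import Summits.QuantumFields.YangMills.Theorems.UnitScaleTiltProp7AvgSeqSpikeMass
import HarnessLib

/-!
# (q-gauge) «FR₂-lite» ROAD (route R2, Cauchy-in-`s`) — **THE FRAME-CORRECTED GAUGE PARAMETER IS A PERTURBED BLOCK `Ad`-AVERAGE, ONE LEVEL, AT A GENERAL FIELD:
# `Λ′(y) = Ad_{w(y)⁻¹}(Avg_P Λ)(y) − w(y)⁻¹·R(y)`, `‖R(y)‖ ≤ 163·‖σ(y)‖·‖τ(y) − 1‖`** — the per-level letter of the mass bound `Σ_z ‖Λ_k(e^{sY}U₀)(z)‖ ≤ C′·ℓ⁻³·‖A‖` on the chart disc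

Cell `ym3-torus` (HUMAN RULING D-0037, YM ladder rung R3 — SU(2) YM₃ on T³: NOT d = 4, NOT infinite volume, NOT a mass gap, NOT Clay).  Width seat `ym3-torus-px16` (gen 15);
THEOREMS ONLY (0 `def`, 0 `sorry`, default heartbeats); `--supports stmt-QuantumFields-19200 --as helper`; count-neutral; NO claim on crux ∕ stub ∕ registry.

WHY.  «FR₂-lite» (the displayed `hFR2` of ✓`Prop7AvgHessGaugeHqGOfFR2.hqG_of_FR2_family`) asks `Σ_z ‖κY Y x A z‖ ≤ C L·ℓ⁻²·s·‖A‖` for F4's chart×gauge mixed derivative `κY`, and F3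
(✓`Prop7FrameResponseAtChartPoint.hasDerivAt_kappaAt_smul`) identifies `κY(z) = d∕ds|₀ Λ_k(s)(z)` with the FRAME-CORRECTED GAUGE PARAMETER `Λ_k(s) = ν⁻¹(N(x̂) − ν̇ν⁻¹)ν` of the spike
`N = δ_x⊗A` at the chart point `sY` (complex `s`).  Route R2 of this seat's LOCATE (19200 evidence #53, `LOCATE-FR2lite-blockcentre-px16g15.md`; numerics kit j340935∕j340942∕j340974∕j340987):
bound `Σ_z‖Λ_k(s)(z)‖ ≤ C′·ℓ⁻³·‖A‖` on the disc `|s| ≤ e·η∕sup‖Y‖` and apply Cauchy.  The tower step at a general field is ✓`Prop7SymFrameGaugeResponseAt.hasDerivAt_frameAccU_succ_at`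
(w5 g6): `ν̇_{k+1}(y) = V(ŷ)·w + ν(ŷ)·D eml(τ)(σ·τ)`, `σ_i = Λ(ŷ) − Ad_{P_i}Λ(x_i)`; this file turns that VALUE into the level recursion for `Λ` and its POINTWISE BOUND: §1 the algebra
`Λ_{k+1}(y) = w⁻¹·(Λ_k(ŷ) − E·w⁻¹)·w` (`E = D eml(τ)(σ·τ)`), §2 the exact split `= Ad_{w⁻¹}(mean_i Ad_{P_i}Λ_k(x_i)) − w⁻¹·(E − (mean σ)·eml τ)` — the `Λ_k(ŷ)` («block-centre») term
CANCELS IDENTICALLY — and §3 the bound by ✓`norm_fderiv_eml_mul_sub_mean_mul_le` (`163`): a block `Ad`-average (ℓ¹-contraction `L⁻³`, ✓`Prop7AvgSeqSpikeMass.sum_norm_avgStep_le`) plus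
an `O(‖τ − 1‖)` defect, `‖τ_j − 1‖` being GEOMETRIC in the level on the chart ball (✓`norm_tstairU_sub_one_le_geom_of_regPr`) — whence a K-free `C′` (the k-level induction is the sequel).

WHAT IS PROVED (any complete normed ℂ-algebra `𝔸`; `meanCLM` over `Idx P`).
* §1 ★ `correctedParam_succ_eq` — `((ν·w)⁻¹·(N₀ − (V₀·w + ν·E)·(ν·w)⁻¹)·(ν·w)) = w⁻¹·(Λ − E·w⁻¹)·w`, `Λ = ν⁻¹·(N₀ − V₀·ν⁻¹)·ν` (the level-`k+1` corrected parameter from w5 g6 §4's value).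
* §2 ★★ `correctedParam_level_eq` — with `(w : 𝔸) = eml τ`, `E = D eml(τ)((Λ₀ − a)·τ)`: `w⁻¹·(Λ₀ − E·w⁻¹)·w = w⁻¹·(mean a)·w − w⁻¹·(E − mean(Λ₀ − a)·eml τ)`.
* §3 ★★★ `norm_correctedParam_level_le` — for `‖τ − 1‖ ≤ 1∕24`: `‖w⁻¹·(Λ₀ − E·w⁻¹)·w‖ ≤ ‖w⁻¹‖·‖w‖·‖mean a‖ + ‖w⁻¹‖·163·‖Λ₀ − a‖·‖τ − 1‖`;
  ★★ `norm_correctedParam_level_le_sum` — the same with `‖mean a‖ ≤ |Idx P|⁻¹·Σ_i ‖a i‖` (the block-mean form consumed by the `L⁻³` contraction).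
HONEST SCOPE.  One-level algebra + one estimate over landed letters; the k-level induction on the disc, the Cauchy step and «FR₂-lite» itself are NOT here; `hqG`, norm_H₁, norm_G, EX, the crux
and rung R3 are NOT proved; the Yang–Mills mass gap is NOT proved.

References: T. Bałaban, CMP **98** (1985) 17–51 [Balaban1985Averaging] ((11) p.19, (82) p.30, (97) p.32); CMP **99** (1985) 389–434 [Balaban1985BackgroundPropagators] ((3.19) p.393,
(3.114)–(3.115) p.418); CMP **109** (1987) 249–301 [Balaban1987RG1] ((0.4)–(0.8) p.253).
-/

set_option autoImplicit false

noncomputable section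

open scoped BigOperators

namespace Summit.QuantumFields.YangMills.Theorems.Prop7CorrectedParamLevelBound

open Finset
open Literature.MathematicalPhysics.QuantumFieldTheory.Balaban1983to89
open T4Continuum BlockAveraging ExpMeanLog
open B7TransferAnalyticMean (meanCLM meanCLM_apply norm_meanCLM_apply_le)
open Summit.QuantumFields.YangMills.Theorems.Prop7SymFrameGaugeResponseAt (norm_fderiv_eml_mul_sub_mean_mul_le)
open Summit.QuantumFields.YangMills.Theorems.Prop7AvgSeqSpikeMass (meanCLM_const card_Idx_pos)

variable {P : Params} {𝔸 : Type*} [NormedRing 𝔸] [NormedAlgebra ℂ 𝔸]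

/-! ## §1 The next corrected parameter from the tower step's value -/

omit [NormedAlgebra ℂ 𝔸] in
/-- ★ **THE LEVEL-`k+1` CORRECTED PARAMETER**: with `ν_{k+1} = ν·w` and w5 g6's `ν̇_{k+1} = V₀·w + ν·E` (✓`hasDerivAt_frameAccU_succ_at`, `E = D eml(τ)(σ·τ)`),
`ν_{k+1}⁻¹·(N₀ − ν̇_{k+1}·ν_{k+1}⁻¹)·ν_{k+1} = w⁻¹·(Λ − E·w⁻¹)·w` where `Λ = ν⁻¹·(N₀ − V₀·ν⁻¹)·ν` is the level-`k` corrected parameter (pure group algebra).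
[cite: Balaban1985Averaging, (97) p.32; Balaban1985BackgroundPropagators, (3.19) p.393] -/
theorem correctedParam_succ_eq (ν w : 𝔸ˣ) (N₀ V₀ E : 𝔸) :
    (((ν * w)⁻¹ : 𝔸ˣ) : 𝔸) * (N₀ - (V₀ * (w : 𝔸) + (ν : 𝔸) * E) * (((ν * w)⁻¹ : 𝔸ˣ) : 𝔸)) * ((ν * w : 𝔸ˣ) : 𝔸)
      = ((w⁻¹ : 𝔸ˣ) : 𝔸) * ((((ν⁻¹ : 𝔸ˣ) : 𝔸) * (N₀ - V₀ * ((ν⁻¹ : 𝔸ˣ) : 𝔸)) * (ν : 𝔸)) - E * ((w⁻¹ : 𝔸ˣ) : 𝔸)) * (w : 𝔸) := by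
  simp only [mul_inv_rev, Units.val_mul, mul_sub, sub_mul, add_mul, mul_add, mul_assoc, Units.mul_inv_cancel_left, Units.inv_mul_cancel_left]
  abel

/-! ## §2 The exact split: a conjugated block `Ad`-average minus the `eml`-defect (the centre term cancels identically) -/

/-- ★★ **THE CORRECTED PARAMETER IS `Ad_{w⁻¹}(mean a) − w⁻¹·R`**: for a stair family `τ` with `eml τ = w`, a centre value `Λ₀` and transported values `a_i` (`= Ad_{P_i}Λ(x_i)`), with the response
`E := D eml(τ)((Λ₀ − a)·τ)` of w5 g6 §3∕§4:  `w⁻¹·(Λ₀ − E·w⁻¹)·w = w⁻¹·(mean a)·w − w⁻¹·(E − mean(Λ₀ − a)·eml τ)` — the `Λ₀`-terms cancel EXACTLY (`mean(Λ₀ − a) = Λ₀ − mean a`), leaving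
the block `Ad`-average of FR₀ conjugated by the frame, minus the `eml`-defect `R = E − (mean σ)·eml τ` of ✓`norm_fderiv_eml_mul_sub_mean_mul_le`.
[cite: Balaban1985Averaging, (82) p.30, (97) p.32; Balaban1987RG1, (0.8) p.253] -/
theorem correctedParam_level_eq (τ : Idx P → 𝔸) (w : 𝔸ˣ) (hw : (w : 𝔸) = eml τ) (Λ₀ : 𝔸) (a : Idx P → 𝔸) :
    ((w⁻¹ : 𝔸ˣ) : 𝔸) * (Λ₀ - fderiv ℂ (eml : (Idx P → 𝔸) → 𝔸) τ ((fun i : Idx P => Λ₀ - a i) * τ) * ((w⁻¹ : 𝔸ˣ) : 𝔸)) * (w : 𝔸)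
      = ((w⁻¹ : 𝔸ˣ) : 𝔸) * meanCLM (Idx P) 𝔸 a * (w : 𝔸)
        - ((w⁻¹ : 𝔸ˣ) : 𝔸) * (fderiv ℂ (eml : (Idx P → 𝔸) → 𝔸) τ ((fun i : Idx P => Λ₀ - a i) * τ) - meanCLM (Idx P) 𝔸 (fun i : Idx P => Λ₀ - a i) * eml τ) := by
  -- `mean(Λ₀ − a) = Λ₀ − mean a`
  have hmean : meanCLM (Idx P) 𝔸 (fun i : Idx P => Λ₀ - a i) = Λ₀ - meanCLM (Idx P) 𝔸 a := by
    have hfun : (fun i : Idx P => Λ₀ - a i) = (fun _ : Idx P => Λ₀) - a := by funext i; rfl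
    rw [hfun, map_sub, meanCLM_const]
  rw [hmean, ← hw]
  simp only [mul_sub, sub_mul, mul_assoc, Units.inv_mul, mul_one]
  abel

/-! ## §3 The pointwise bound -/

/-- ★★★ **THE ONE-LEVEL CORRECTED PARAMETER IS BOUNDED BY THE BLOCK MEAN PLUS AN `O(‖τ − 1‖)` DEFECT**: for `‖τ − 1‖ ≤ 1∕24`,
`‖w⁻¹·(Λ₀ − E·w⁻¹)·w‖ ≤ ‖w⁻¹‖·‖w‖·‖mean a‖ + ‖w⁻¹‖·(163·‖Λ₀ − a‖·‖τ − 1‖)` — §2 and ✓`norm_fderiv_eml_mul_sub_mean_mul_le`.  The first term contracts the site mass by `L⁻³`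
(✓`sum_norm_avgStep_le` shape), the second is first-order in the tower closeness `‖τ_j − 1‖ ≲ (2e + 2700Lε₀)·60L·Lʲη` (✓`norm_tstairU_sub_one_le_geom_of_regPr`), geometric in `j`.
[cite: Balaban1985Averaging, (82) p.30, (97) p.32; Balaban1985BackgroundPropagators, (3.19) p.393; Balaban1987RG1, (0.8) p.253] -/
theorem norm_correctedParam_level_le [CompleteSpace 𝔸] {τ : Idx P → 𝔸} (hτ : ‖τ - 1‖ ≤ 1 / 24) (w : 𝔸ˣ) (hw : (w : 𝔸) = eml τ) (Λ₀ : 𝔸) (a : Idx P → 𝔸) :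
    ‖((w⁻¹ : 𝔸ˣ) : 𝔸) * (Λ₀ - fderiv ℂ (eml : (Idx P → 𝔸) → 𝔸) τ ((fun i : Idx P => Λ₀ - a i) * τ) * ((w⁻¹ : 𝔸ˣ) : 𝔸)) * (w : 𝔸)‖
      ≤ ‖((w⁻¹ : 𝔸ˣ) : 𝔸)‖ * ‖(w : 𝔸)‖ * ‖meanCLM (Idx P) 𝔸 a‖ + ‖((w⁻¹ : 𝔸ˣ) : 𝔸)‖ * (163 * ‖(fun i : Idx P => Λ₀ - a i)‖ * ‖τ - 1‖) := by
  rw [correctedParam_level_eq τ w hw Λ₀ a]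
  have hR := norm_fderiv_eml_mul_sub_mean_mul_le (ι := Idx P) (𝔸 := 𝔸) hτ (fun i : Idx P => Λ₀ - a i)
  calc ‖((w⁻¹ : 𝔸ˣ) : 𝔸) * meanCLM (Idx P) 𝔸 a * (w : 𝔸)
          - ((w⁻¹ : 𝔸ˣ) : 𝔸) * (fderiv ℂ (eml : (Idx P → 𝔸) → 𝔸) τ ((fun i : Idx P => Λ₀ - a i) * τ) - meanCLM (Idx P) 𝔸 (fun i : Idx P => Λ₀ - a i) * eml τ)‖
      ≤ ‖((w⁻¹ : 𝔸ˣ) : 𝔸) * meanCLM (Idx P) 𝔸 a * (w : 𝔸)‖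
          + ‖((w⁻¹ : 𝔸ˣ) : 𝔸) * (fderiv ℂ (eml : (Idx P → 𝔸) → 𝔸) τ ((fun i : Idx P => Λ₀ - a i) * τ) - meanCLM (Idx P) 𝔸 (fun i : Idx P => Λ₀ - a i) * eml τ)‖ :=
        norm_sub_le _ _
    _ ≤ ‖((w⁻¹ : 𝔸ˣ) : 𝔸)‖ * ‖meanCLM (Idx P) 𝔸 a‖ * ‖(w : 𝔸)‖
          + ‖((w⁻¹ : 𝔸ˣ) : 𝔸)‖ * ‖fderiv ℂ (eml : (Idx P → 𝔸) → 𝔸) τ ((fun i : Idx P => Λ₀ - a i) * τ) - meanCLM (Idx P) 𝔸 (fun i : Idx P => Λ₀ - a i) * eml τ‖ := by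
        gcongr
        · exact (norm_mul_le _ _).trans (mul_le_mul_of_nonneg_right (norm_mul_le _ _) (norm_nonneg _))
        · exact norm_mul_le _ _
    _ ≤ ‖((w⁻¹ : 𝔸ˣ) : 𝔸)‖ * ‖(w : 𝔸)‖ * ‖meanCLM (Idx P) 𝔸 a‖ + ‖((w⁻¹ : 𝔸ˣ) : 𝔸)‖ * (163 * ‖(fun i : Idx P => Λ₀ - a i)‖ * ‖τ - 1‖) := by
        have h1 : ‖((w⁻¹ : 𝔸ˣ) : 𝔸)‖ * ‖meanCLM (Idx P) 𝔸 a‖ * ‖(w : 𝔸)‖ = ‖((w⁻¹ : 𝔸ˣ) : 𝔸)‖ * ‖(w : 𝔸)‖ * ‖meanCLM (Idx P) 𝔸 a‖ := by ring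
        rw [h1]
        gcongr

/-- ★★ **BLOCK-MEAN FORM**: the same with `‖mean a‖ ≤ |Idx P|⁻¹·Σ_i ‖a i‖` — for `a_i = P_i·Λ(x_i)·P_i⁻¹` with norm-non-expanding `P_i` this is `|Idx P|⁻¹·Σ_i ‖Λ(x_i)‖`, the block mean of
✓`Prop7AvgSeqSpikeMass.sum_norm_avgStep_le` (ℓ¹-contraction `(L^d)⁻¹`). [cite: Balaban1985Averaging, (11) p.19, (97) p.32; Balaban1987RG1, (0.3)–(0.4) pp.252–253] -/
theorem norm_correctedParam_level_le_sum [CompleteSpace 𝔸] {τ : Idx P → 𝔸} (hτ : ‖τ - 1‖ ≤ 1 / 24) (w : 𝔸ˣ) (hw : (w : 𝔸) = eml τ) (Λ₀ : 𝔸) (a : Idx P → 𝔸) :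
    ‖((w⁻¹ : 𝔸ˣ) : 𝔸) * (Λ₀ - fderiv ℂ (eml : (Idx P → 𝔸) → 𝔸) τ ((fun i : Idx P => Λ₀ - a i) * τ) * ((w⁻¹ : 𝔸ˣ) : 𝔸)) * (w : 𝔸)‖
      ≤ ‖((w⁻¹ : 𝔸ˣ) : 𝔸)‖ * ‖(w : 𝔸)‖ * ((Fintype.card (Idx P) : ℝ)⁻¹ * ∑ i : Idx P, ‖a i‖)
        + ‖((w⁻¹ : 𝔸ˣ) : 𝔸)‖ * (163 * ‖(fun i : Idx P => Λ₀ - a i)‖ * ‖τ - 1‖) := by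
  have hmean : ‖meanCLM (Idx P) 𝔸 a‖ ≤ (Fintype.card (Idx P) : ℝ)⁻¹ * ∑ i : Idx P, ‖a i‖ := by
    rw [meanCLM_apply]
    have hcard : ‖((Fintype.card (Idx P) : ℂ))⁻¹‖ = (Fintype.card (Idx P) : ℝ)⁻¹ := by
      rw [norm_inv, Complex.norm_natCast]
    calc ‖((Fintype.card (Idx P) : ℂ))⁻¹ • ∑ i : Idx P, a i‖ ≤ ‖((Fintype.card (Idx P) : ℂ))⁻¹‖ * ‖∑ i : Idx P, a i‖ := norm_smul_le _ _
      _ ≤ (Fintype.card (Idx P) : ℝ)⁻¹ * ∑ i : Idx P, ‖a i‖ := by rw [hcard]; exact mul_le_mul_of_nonneg_left (norm_sum_le _ _) (inv_nonneg.2 (card_Idx_pos (P := P)).le)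
  calc _ ≤ ‖((w⁻¹ : 𝔸ˣ) : 𝔸)‖ * ‖(w : 𝔸)‖ * ‖meanCLM (Idx P) 𝔸 a‖ + ‖((w⁻¹ : 𝔸ˣ) : 𝔸)‖ * (163 * ‖(fun i : Idx P => Λ₀ - a i)‖ * ‖τ - 1‖) :=
        norm_correctedParam_level_le hτ w hw Λ₀ a
    _ ≤ _ := by gcongr

end Summit.QuantumFields.YangMills.Theorems.Prop7CorrectedParamLevelBound

end
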